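import Literature.NumberTheory.PAdicHodge.TateTraceFixedLinear
import Mathlib.LinearAlgebra.Matrix.NonsingularInverse
import HarnessLib

/-!
# Sen's uniqueness lemma over the cyclotomic tower (Berger–Colmez, Lemme 3.2.5) and the propagation
# of decompletion along commuting elements

Notation as in `SenDecompletionMatrix`: `K₀ ≅ ℚ_p`, `ℂ_F`, `X = \widehat{K_∞} ⊆ ℂ_F`, `K n = K₀(ζ_{pⁿ})`,
`γ = γ_n = TateTrace.gen n` (`n ≥ 2`), `R_n = TateTrace.Rhat n`, `π = ‖p‖`; matrices over a finite index
type `m`, measured entrywise; `G₀ = BaseGaloisGroup` acting on `ℂ_F` entrywise on matrices.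

## Main results

* `TateTrace.isUnit_det_and_norm_inv_sub_one_le` — **Berger–Colmez Lemme 3.1.2** over `ℂ_F`: a matrix `W`
  with `‖W − 1‖ ≤ r < 1` is invertible and `‖W⁻¹ − 1‖ ≤ r`.
* ★ `TateTrace.matrix_gen_smul_eq_of_map_eq_mul_mul` — **Berger–Colmez Lemme 3.2.5 (cyclotomic tower,
  `Λ̃ = ℂ_F`, `c₃ = 2`).** If `B ∈ M_d(X)` and `V₁, V₂ ∈ M_d(X)` are fixed by `γ_n` entrywise (i.e. lie in
  `M_d(K_n)`) with `‖V₁ − 1‖, ‖V₂ − 1‖ ≤ r < ‖p‖²`, and `γ_n(B) = V₁ B V₂`, then `γ_n` fixes `B` (so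
  `B ∈ M_d(K_n)`). Proof: `C = B − R_n(B)` satisfies `γ(C) = V₁ C V₂` because `R_n` is linear over the
  `γ`-invariants (`TateTrace.Rhat_mul_of_gen_smul_eq`, (TS2)(2)) and commutes with `γ`; then
  `‖γC − C‖ ≤ r ‖C‖` while Tate's (TS3) gives `‖C‖ ≤ ‖p‖⁻² ‖γC − C‖`, forcing `C = 0`.
* ★ `TateTrace.matrix_gen_smul_eq_of_map_eq_inv_mul_map` — **propagation (the last step of Berger–Colmez
  Prop. 3.2.6).** If `W ∈ M_d(X)^{γ=1}` with `‖W − 1‖ ≤ r < ‖p‖²`, `τ ∈ G₀`, and `V ∈ M_d(X)` satisfies the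
  twisted commutation relation `γ(V) = W⁻¹ · V · τ(W)` (which the cocycle relation
  `V_γ γ(V_τ) = V_{γτ} = V_{τγ} = V_τ τ(V_γ)` yields for `W = V_γ`, `V = V_τ`, as `G₀` acts on `X` through
  its abelian quotient), then `γ` fixes `V`: once the value at `γ` of a cocycle has been decompleted
  (`TateTrace.exists_matrix_conj_fixed`), ALL its values are.

No named facts are used.

References: L. Berger, P. Colmez, Astérisque 319 (2008), Lemme 3.1.2, Déf. 3.1.3, Lemme 3.2.5,
Prop. 3.2.6 [BergerColmez2008]; J. Tate, *p-divisible groups* (1967), §3.1, §3.2 Prop. 7 [Tate1967].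
-/

noncomputable section

open ValuativeRel Field UniformSpace Filter Topology Finset

open scoped IntermediateField

namespace Literature.NumberTheory.PAdicHodge

open Literature.NumberTheory.GaloisRepresentations
open Literature.NumberTheory.GaloisRepresentations.IsNonarchimedeanLocalField
open CyclotomicTower

variable {F : Type} [Field F] [ValuativeRel F] [TopologicalSpace F] [IsNonarchimedeanLocalField F]
  [CharZero F] {p : ℕ} [Fact p.Prime] (hp : valuation F p < 1)

namespace TateTrace

variable {m : Type} [Fintype m] [DecidableEq m]

/-! ### Ultrametric matrix toolkit over `ℂ_F` -/

omit [CharZero F] in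
/-- `‖x + y‖ ≤ max ‖x‖ ‖y‖` in `ℂ_F`. [folklore] -/
private theorem norm_add_le_max' (x y : CompletedAlgClosure F) : ‖x + y‖ ≤ max ‖x‖ ‖y‖ :=
  IsUltrametricDist.norm_add_le_max x y

omit [CharZero F] in
/-- `‖x - y‖ ≤ max ‖x‖ ‖y‖` in `ℂ_F`. [folklore] -/
private theorem norm_sub_le_max' (x y : CompletedAlgClosure F) : ‖x - y‖ ≤ max ‖x‖ ‖y‖ := by
  rw [sub_eq_add_neg, ← norm_neg y]; exact IsUltrametricDist.norm_add_le_max x (-y)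

omit [CharZero F] in
/-- `‖1 + c‖ = 1` when `‖c‖ < 1`. [folklore] -/
private theorem norm_one_add_eq {c : CompletedAlgClosure F} (hc : ‖c‖ < 1) : ‖1 + c‖ = 1 := by
  have h := IsUltrametricDist.norm_add_eq_max_of_norm_ne_norm (x := (1 : CompletedAlgClosure F)) (y := c)
    (by rw [norm_one]; exact hc.ne')
  rw [h, norm_one, max_eq_left hc.le]

omit [CharZero F] [DecidableEq m] in
/-- Entrywise bounds are submultiplicative over the ultrametric field `ℂ_F`:
`‖(A B) i j‖ ≤ (sup ‖A‖)(sup ‖B‖)`. [folklore] -/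
private theorem norm_mul_apply_le {A B : Matrix m m (CompletedAlgClosure F)} {a b : ℝ} (ha : 0 ≤ a)
    (hb : 0 ≤ b) (hA : ∀ i j, ‖A i j‖ ≤ a) (hB : ∀ i j, ‖B i j‖ ≤ b) (i j : m) :
    ‖(A * B) i j‖ ≤ a * b := by
  rw [Matrix.mul_apply]
  exact IsUltrametricDist.norm_sum_le_of_forall_le_of_nonneg (mul_nonneg ha hb)
    fun k _ => by rw [norm_mul]; exact mul_le_mul (hA i k) (hB k j) (norm_nonneg _) ha

omit [CharZero F] [Fintype m] [DecidableEq m] in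
/-- `‖(A - B) i j‖ ≤ max`. [folklore] -/
private theorem norm_sub_apply_le {A B : Matrix m m (CompletedAlgClosure F)} {a b : ℝ}
    (hA : ∀ i j, ‖A i j‖ ≤ a) (hB : ∀ i j, ‖B i j‖ ≤ b) (i j : m) :
    ‖(A - B) i j‖ ≤ max a b := by
  rw [Matrix.sub_apply]
  exact (norm_sub_le_max' _ _).trans (max_le_max (hA i j) (hB i j))

omit [CharZero F] [Fintype m] [DecidableEq m] in
/-- `‖(A + B) i j‖ ≤ max`. [folklore] -/
private theorem norm_add_apply_le {A B : Matrix m m (CompletedAlgClosure F)} {a b : ℝ}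
    (hA : ∀ i j, ‖A i j‖ ≤ a) (hB : ∀ i j, ‖B i j‖ ≤ b) (i j : m) :
    ‖(A + B) i j‖ ≤ max a b := by
  rw [Matrix.add_apply]
  exact (norm_add_le_max' _ _).trans (max_le_max (hA i j) (hB i j))

omit [CharZero F] in
/-- The determinant of a matrix with entries of norm `≤ 1` has norm `≤ 1`. [folklore] -/
private theorem norm_det_le_one {A : Matrix m m (CompletedAlgClosure F)} (hA : ∀ i j, ‖A i j‖ ≤ 1) :
    ‖A.det‖ ≤ 1 := by
  rw [Matrix.det_apply']
  refine IsUltrametricDist.norm_sum_le_of_forall_le_of_nonneg zero_le_one fun σ _ => ?_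
  have h1 : ‖(((Equiv.Perm.sign σ : ℤˣ) : ℤ) : CompletedAlgClosure F)‖ = 1 := by
    rcases Int.units_eq_one_or (Equiv.Perm.sign σ) with h | h <;> simp [h]
  rw [norm_mul, h1, one_mul, norm_prod]
  exact Finset.prod_le_one (fun i _ => norm_nonneg _) fun i _ => hA _ _

omit [CharZero F] [Fintype m] in
/-- Entries of `1 + C`, `‖C‖ ≤ r ≤ 1`: norm `≤ 1`, and the off-diagonal ones `≤ r`. [folklore] -/
private theorem norm_one_add_apply_le {C : Matrix m m (CompletedAlgClosure F)} {r : ℝ} (hr1 : r ≤ 1)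
    (hC : ∀ i j, ‖C i j‖ ≤ r) (i j : m) :
    ‖(1 + C : Matrix m m (CompletedAlgClosure F)) i j‖ ≤ 1 ∧
      (i ≠ j → ‖(1 + C : Matrix m m (CompletedAlgClosure F)) i j‖ ≤ r) := by
  rw [Matrix.add_apply]
  by_cases hij : i = j
  · subst hij
    rw [Matrix.one_apply_eq]
    refine ⟨(norm_add_le_max' _ _).trans ?_, fun h => (h rfl).elim⟩
    rw [norm_one]; exact max_le le_rfl ((hC i i).trans hr1)
  · rw [Matrix.one_apply_ne hij, zero_add]
    exact ⟨(hC i j).trans hr1, fun _ => hC i j⟩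

omit [CharZero F] [Fintype m] in
/-- `‖∏ (1 + c_i) − 1‖ ≤ r` when all `‖c_i‖ ≤ r ≤ 1`. [folklore] -/
private theorem norm_prod_one_add_sub_one_le {s : Finset m} {c : m → CompletedAlgClosure F} {r : ℝ}
    (hr0 : 0 ≤ r) (hr1 : r ≤ 1) (hc : ∀ i, ‖c i‖ ≤ r) : ‖∏ i ∈ s, (1 + c i) - 1‖ ≤ r := by
  induction s using Finset.induction_on with
  | empty => rw [Finset.prod_empty, sub_self, norm_zero]; exact hr0
  | @insert a s ha ih =>
    rw [Finset.prod_insert ha]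
    set P := ∏ i ∈ s, (1 + c i)
    have hP : ‖P‖ ≤ 1 := by
      have h := norm_add_le_max' (P - 1) 1
      rw [sub_add_cancel, norm_one] at h
      exact h.trans (max_le (ih.trans hr1) le_rfl)
    have h : (1 + c a) * P - 1 = (P - 1) + c a * P := by ring
    rw [h]
    refine (norm_add_le_max' _ _).trans (max_le ih ?_)
    rw [norm_mul]
    calc ‖c a‖ * ‖P‖ ≤ r * 1 := mul_le_mul (hc a) hP (norm_nonneg _) hr0
      _ = r := mul_one r

omit [CharZero F] in
/-- **`‖det(1 + C) − 1‖ ≤ ‖C‖` for `‖C‖ < 1`** (Leibniz expansion: the diagonal term is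
`∏(1 + C_ii)`, every other term has an off-diagonal factor). [folklore] -/
private theorem norm_det_one_add_sub_one_le {C : Matrix m m (CompletedAlgClosure F)} {r : ℝ}
    (hr0 : 0 ≤ r) (hr1 : r < 1) (hC : ∀ i j, ‖C i j‖ ≤ r) :
    ‖(1 + C : Matrix m m (CompletedAlgClosure F)).det - 1‖ ≤ r := by
  have hent := norm_one_add_apply_le hr1.le hC
  rw [Matrix.det_apply', ← Finset.sum_erase_add _ _ (Finset.mem_univ (1 : Equiv.Perm m))]
  simp only [Equiv.Perm.sign_one, Units.val_one, Int.cast_one, one_mul, Equiv.Perm.one_apply]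
  rw [add_sub_assoc]
  refine (norm_add_le_max' _ _).trans (max_le ?_ ?_)
  · refine IsUltrametricDist.norm_sum_le_of_forall_le_of_nonneg hr0 fun σ hσ => ?_
    have hσ1 : σ ≠ 1 := Finset.ne_of_mem_erase hσ
    obtain ⟨i₀, hi₀⟩ : ∃ i, σ i ≠ i := not_forall.mp fun h => hσ1 (Equiv.ext h)
    have h1 : ‖(((Equiv.Perm.sign σ : ℤˣ) : ℤ) : CompletedAlgClosure F)‖ = 1 := by
      rcases Int.units_eq_one_or (Equiv.Perm.sign σ) with h | h <;> simp [h]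
    rw [norm_mul, h1, one_mul, ← Finset.prod_erase_mul _ _ (Finset.mem_univ i₀), norm_mul]
    calc ‖∏ i ∈ Finset.univ.erase i₀, (1 + C : Matrix m m (CompletedAlgClosure F)) (σ i) i‖ *
          ‖(1 + C : Matrix m m (CompletedAlgClosure F)) (σ i₀) i₀‖ ≤ 1 * r := by
          refine mul_le_mul ?_ ((hent _ _).2 hi₀) (norm_nonneg _) zero_le_one
          rw [norm_prod]
          exact Finset.prod_le_one (fun i _ => norm_nonneg _) fun i _ => (hent _ _).1
      _ = r := one_mul r
  · simp only [Matrix.add_apply, Matrix.one_apply_eq]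
    exact norm_prod_one_add_sub_one_le hr0 hr1.le fun i => hC i i

omit [CharZero F] in
/-- **`1 + C` is invertible for `‖C‖ < 1`**, with `‖det(1 + C)‖ = 1`. [folklore] -/
private theorem norm_det_one_add_eq_one {C : Matrix m m (CompletedAlgClosure F)} {r : ℝ}
    (hr0 : 0 ≤ r) (hr1 : r < 1) (hC : ∀ i j, ‖C i j‖ ≤ r) :
    ‖(1 + C : Matrix m m (CompletedAlgClosure F)).det‖ = 1 := by
  have h := norm_det_one_add_sub_one_le hr0 hr1 hC
  have h1 : (1 + C : Matrix m m (CompletedAlgClosure F)).det =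
      1 + ((1 + C : Matrix m m (CompletedAlgClosure F)).det - 1) := by ring
  rw [h1]
  exact norm_one_add_eq (h.trans_lt hr1)

omit [CharZero F] in
/-- `B` with `‖B − 1‖ < 1` (entrywise `≤ r < 1`) has `‖det B‖ = 1`, so is invertible. [folklore] -/
private theorem isUnit_det_of_norm_sub_one_le {B : Matrix m m (CompletedAlgClosure F)} {r : ℝ}
    (hr0 : 0 ≤ r) (hr1 : r < 1) (hB : ∀ i j, ‖(B - 1) i j‖ ≤ r) : IsUnit B.det := by
  have h := norm_det_one_add_eq_one hr0 hr1 hB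
  rw [add_sub_cancel] at h
  refine isUnit_iff_ne_zero.mpr fun h0 => ?_
  rw [h0, norm_zero] at h
  exact zero_ne_one h

omit [CharZero F] in
/-- **`‖(1 + C)⁻¹‖ ≤ 1` for `‖C‖ < 1`** (adjugate formula). [folklore] -/
private theorem norm_inv_one_add_apply_le {C : Matrix m m (CompletedAlgClosure F)} {r : ℝ}
    (hr0 : 0 ≤ r) (hr1 : r < 1) (hC : ∀ i j, ‖C i j‖ ≤ r) (i j : m) :
    ‖(1 + C : Matrix m m (CompletedAlgClosure F))⁻¹ i j‖ ≤ 1 := by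
  have hdet := norm_det_one_add_eq_one hr0 hr1 hC
  have hent := norm_one_add_apply_le hr1.le hC
  rw [Matrix.inv_def, Matrix.smul_apply, smul_eq_mul, Ring.inverse_eq_inv, norm_mul, norm_inv, hdet,
    inv_one, one_mul, Matrix.adjugate_apply]
  refine norm_det_le_one fun i' j' => ?_
  rw [Matrix.updateRow_apply]
  split_ifs with h
  · by_cases hij : j' = i
    · subst hij; rw [Pi.single_eq_same, norm_one]
    · rw [Pi.single_eq_of_ne hij, norm_zero]; exact zero_le_one
  · exact (hent _ _).1

/-! ### Matrices with entries in the subfield `X` -/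

/-- `X` as a subring of `ℂ_F` (existence only; no new constant). [folklore] -/
private theorem exists_subring_coe_eq_X :
    ∃ R : Subring (CompletedAlgClosure F), (R : Set (CompletedAlgClosure F)) = X hp :=
  ⟨{ carrier := X hp
     mul_mem' := fun ha hb => mul_mem_X hp ha hb
     one_mem' := one_mem_X hp
     add_mem' := fun ha hb => add_mem_X hp ha hb
     zero_mem' := zero_mem_X hp
     neg_mem' := fun ha => neg_mem_X hp ha }, rfl⟩

omit [DecidableEq m] in
/-- Products of matrices over `X` are over `X`. [folklore] -/
private theorem mul_apply_mem_X {A B : Matrix m m (CompletedAlgClosure F)} (hA : ∀ i j, A i j ∈ X hp)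
    (hB : ∀ i j, B i j ∈ X hp) (i j : m) : (A * B) i j ∈ X hp := by
  rw [Matrix.mul_apply]
  exact sum_mem_X hp _ _ fun k _ => mul_mem_X hp (hA i k) (hB k j)

omit [Fintype m] [DecidableEq m] in
/-- Sums / differences / `1` / `γ`-images of matrices over `X` are over `X`. [folklore] -/
private theorem add_apply_mem_X {A B : Matrix m m (CompletedAlgClosure F)} (hA : ∀ i j, A i j ∈ X hp)
    (hB : ∀ i j, B i j ∈ X hp) (i j : m) : (A + B) i j ∈ X hp := by
  rw [Matrix.add_apply]; exact add_mem_X hp (hA i j) (hB i j)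

omit [Fintype m] [DecidableEq m] in
/-- see `add_apply_mem_X`. [folklore] -/
private theorem sub_apply_mem_X {A B : Matrix m m (CompletedAlgClosure F)} (hA : ∀ i j, A i j ∈ X hp)
    (hB : ∀ i j, B i j ∈ X hp) (i j : m) : (A - B) i j ∈ X hp := by
  rw [Matrix.sub_apply]; exact sub_mem_X hp (hA i j) (hB i j)

omit [Fintype m] in
/-- see `add_apply_mem_X`. [folklore] -/
private theorem one_apply_mem_X (i j : m) : (1 : Matrix m m (CompletedAlgClosure F)) i j ∈ X hp := by
  rw [Matrix.one_apply]
  split_ifs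
  · exact one_mem_X hp
  · exact zero_mem_X hp

omit [Fintype m] [DecidableEq m] in
/-- see `add_apply_mem_X`. [folklore] -/
private theorem map_smul_apply_mem_X (g : BaseGaloisGroup hp) {A : Matrix m m (CompletedAlgClosure F)}
    (hA : ∀ i j, A i j ∈ X hp) (i j : m) : (A.map fun x => g • x) i j ∈ X hp := by
  rw [Matrix.map_apply]; exact smul_mem_X hp g (hA i j)

/-- The inverse of a matrix over the subfield `X` is over `X` (adjugate and determinant are
polynomials in the entries). [folklore] -/
private theorem inv_apply_mem_X {A : Matrix m m (CompletedAlgClosure F)} (hA : ∀ i j, A i j ∈ X hp)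
    (i j : m) : A⁻¹ i j ∈ X hp := by
  obtain ⟨R, hR⟩ := exists_subring_coe_eq_X hp
  have hmem : ∀ i j, A i j ∈ R := fun i j => by rw [← SetLike.mem_coe, hR]; exact hA i j
  set A' : Matrix m m R := fun i j => ⟨A i j, hmem i j⟩ with hA'
  have hAA' : R.subtype.mapMatrix A' = A := by
    ext i j; rfl
  have hdet : A.det ∈ X hp := by
    rw [← hR, SetLike.mem_coe, ← hAA', ← RingHom.map_det]
    exact (A'.det).2
  have hadj : A.adjugate i j ∈ X hp := by
    rw [← hR, SetLike.mem_coe, ← hAA', ← RingHom.map_adjugate]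
    exact (A'.adjugate i j).2
  rw [Matrix.inv_def, Matrix.smul_apply, smul_eq_mul, Ring.inverse_eq_inv]
  exact mul_mem_X hp (inv_mem_X hp hdet) hadj


omit [Fintype m] in
/-- `G₀` fixes the entries of the identity matrix. [folklore] -/
private theorem smul_one_apply (g : BaseGaloisGroup hp) (i j : m) :
    g • (1 : Matrix m m (CompletedAlgClosure F)) i j = (1 : Matrix m m (CompletedAlgClosure F)) i j := by
  rw [Matrix.one_apply]
  split_ifs
  · exact smul_one g
  · exact smul_zero g

/-- `γ_n` fixes `K n` pointwise. [folklore] -/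
private theorem gen_smul_eq_self_of_mem_K {n : ℕ} (hn : 1 ≤ n) {x : NormedAlgClosure F}
    (hx : x ∈ K hp n) : gen hp n • x = x := by
  have h := gen_smul_zeta_self hp hn
  have h1 : gen hp n • zeta F p n = (1 : BaseGaloisGroup hp) • zeta F p n := by rw [h, one_smul]
  have h2 := smul_eq_smul_of_smul_zeta_eq hp h1 hx
  rwa [one_smul] at h2

/-- `G₀` preserves the `γ_n`-invariants of `X` (it acts on `X ⊇ K n` through an abelian quotient).
[folklore] -/
private theorem gen_smul_base_smul_eq {n : ℕ} (hn : 2 ≤ n) (τ : BaseGaloisGroup hp)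
    {w : CompletedAlgClosure F} (hwX : w ∈ X hp) (hγw : gen hp n • w = w) :
    gen hp n • τ • w = τ • w := by
  obtain ⟨w₀, hw₀, rfl⟩ := mem_image_K_of_gen_smul_eq hp hn hwX hγw
  rw [CompletedAlgClosure.base_smul_coe, CompletedAlgClosure.base_smul_coe,
    gen_smul_eq_self_of_mem_K hp (by omega) (smul_mem_K hp τ hw₀)]

/-! ### Berger–Colmez, Lemme 3.1.2: small perturbations of `1` are invertible -/

omit [CharZero F] in
/-- **Berger–Colmez, Lemme 3.1.2** (over `ℂ_F`, entrywise norms): if `‖W − 1‖ ≤ r < 1` then `W` is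
invertible (`det W` is a unit, indeed of norm `1`) and `‖W⁻¹ − 1‖ ≤ r`.
[cite: BergerColmez2008, Lemme 3.1.2] -/
theorem isUnit_det_and_norm_inv_sub_one_le {W : Matrix m m (CompletedAlgClosure F)} {r : ℝ}
    (hr0 : 0 ≤ r) (hr1 : r < 1) (hW : ∀ i j, ‖(W - 1) i j‖ ≤ r) :
    IsUnit W.det ∧ ∀ i j, ‖(W⁻¹ - 1) i j‖ ≤ r := by
  have hdet : IsUnit W.det := isUnit_det_of_norm_sub_one_le hr0 hr1 hW
  refine ⟨hdet, fun i j => ?_⟩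
  have hW1 : W = 1 + (W - 1) := by abel
  have hinv : ∀ i j, ‖W⁻¹ i j‖ ≤ 1 := by
    rw [hW1]; exact norm_inv_one_add_apply_le hr0 hr1 hW
  have h : W⁻¹ - 1 = W⁻¹ * (1 - W) := by
    rw [Matrix.mul_sub, Matrix.mul_one, Matrix.nonsing_inv_mul W hdet]
  have h1W : ∀ i j, ‖(1 - W) i j‖ ≤ r := fun i j => by
    rw [← neg_sub, Matrix.neg_apply, norm_neg]; exact hW i j
  rw [h]
  exact (norm_mul_apply_le zero_le_one hr0 hinv h1W i j).trans (le_of_eq (one_mul r))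

/-! ### Berger–Colmez, Lemme 3.2.5: uniqueness -/

omit [DecidableEq m] in
/-- **`R_n` entrywise commutes with two-sided multiplication by `γ_n`-fixed matrices**:
`R_n((V₁ B V₂)_{ij}) = (V₁ R_n(B) V₂)_{ij}` ((TS2)(2), `TateTrace.Rhat_mul_mul_of_gen_smul_eq`, summed).
[cite: BergerColmez2008, Déf. 3.1.3 (TS2)(2) and Lemme 3.2.5] -/
theorem Rhat_mul_mul_apply {n : ℕ} (hn : 2 ≤ n) {B V₁ V₂ : Matrix m m (CompletedAlgClosure F)}
    (hB : ∀ i j, B i j ∈ X hp) (hV₁ : ∀ i j, V₁ i j ∈ X hp) (hV₂ : ∀ i j, V₂ i j ∈ X hp)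
    (hγV₁ : ∀ i j, gen hp n • V₁ i j = V₁ i j) (hγV₂ : ∀ i j, gen hp n • V₂ i j = V₂ i j) (i j : m)
    (h : (V₁ * B * V₂) i j ∈ X hp) :
    Rhat hp n ⟨(V₁ * B * V₂) i j, h⟩ =
      (V₁ * (Matrix.of fun k l => Rhat hp n ⟨B k l, hB k l⟩) * V₂) i j := by
  -- expand both sides as double sums
  have hterm : ∀ l k, V₁ i k * ((⟨B k l, hB k l⟩ : X hp) : CompletedAlgClosure F) * V₂ l j ∈ X hp :=
    fun l k => mul_mem_X hp (mul_mem_X hp (hV₁ i k) (hB k l)) (hV₂ l j)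
  have hinner : ∀ l, ∑ k, V₁ i k * ((⟨B k l, hB k l⟩ : X hp) : CompletedAlgClosure F) * V₂ l j ∈ X hp :=
    fun l => sum_mem_X hp _ _ fun k _ => hterm l k
  have hexp : (V₁ * B * V₂) i j =
      ∑ l, ∑ k, V₁ i k * ((⟨B k l, hB k l⟩ : X hp) : CompletedAlgClosure F) * V₂ l j := by
    rw [Matrix.mul_apply]
    refine Finset.sum_congr rfl fun l _ => ?_
    rw [Matrix.mul_apply, Finset.sum_mul]
  have hexp' : (V₁ * (Matrix.of fun k l => Rhat hp n ⟨B k l, hB k l⟩) * V₂) i j =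
      ∑ l, ∑ k, V₁ i k * Rhat hp n ⟨B k l, hB k l⟩ * V₂ l j := by
    rw [Matrix.mul_apply]
    refine Finset.sum_congr rfl fun l _ => ?_
    rw [Matrix.mul_apply, Finset.sum_mul]
    rfl
  have h1 : (⟨(V₁ * B * V₂) i j, h⟩ : X hp) =
      ⟨∑ l, ∑ k, V₁ i k * ((⟨B k l, hB k l⟩ : X hp) : CompletedAlgClosure F) * V₂ l j,
        sum_mem_X hp _ _ fun l _ => hinner l⟩ := Subtype.ext hexp
  rw [h1, Rhat_sum hp hn Finset.univ _ hinner, hexp']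
  refine Finset.sum_congr rfl fun l _ => ?_
  rw [Rhat_sum hp hn Finset.univ _ (hterm l)]
  refine Finset.sum_congr rfl fun k _ => ?_
  exact Rhat_mul_mul_of_gen_smul_eq hp hn (hV₁ i k) (hγV₁ i k) (hV₂ l j) (hγV₂ l j) ⟨B k l, hB k l⟩

/-- ★ **Berger–Colmez, Lemme 3.2.5 (cyclotomic tower, `Λ̃ = ℂ_F`, `H = H_{K₀}`, `c₃ = 2`).** Let `n ≥ 2`,
`γ = γ_n`, `B ∈ M_d(X)`, and let `V₁, V₂ ∈ M_d(X)` be fixed by `γ` entrywise (`= M_d(K_n)`) with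
`‖V₁ − 1‖, ‖V₂ − 1‖ ≤ r < ‖p‖²` (entrywise). If `γ(B) = V₁ · B · V₂` then `γ` fixes `B` entrywise
(`B ∈ M_d(K_n)`, `TateTrace.mem_image_K_of_gen_smul_eq`).
[cite: BergerColmez2008, Lemme 3.2.5] [cite: Tate1967, §3.2 Prop. 7] -/
theorem matrix_gen_smul_eq_of_map_eq_mul_mul {n : ℕ} (hn : 2 ≤ n)
    {B V₁ V₂ : Matrix m m (CompletedAlgClosure F)} (hB : ∀ i j, B i j ∈ X hp)
    (hV₁ : ∀ i j, V₁ i j ∈ X hp) (hV₂ : ∀ i j, V₂ i j ∈ X hp)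
    (hγV₁ : ∀ i j, gen hp n • V₁ i j = V₁ i j) (hγV₂ : ∀ i j, gen hp n • V₂ i j = V₂ i j)
    {r : ℝ} (hr : r < ‖(p : PadicBase F p hp)‖ ^ 2) (hV₁r : ∀ i j, ‖(V₁ - 1) i j‖ ≤ r)
    (hV₂r : ∀ i j, ‖(V₂ - 1) i j‖ ≤ r)
    (hγB : (B.map fun x => gen hp n • x) = V₁ * B * V₂) :
    ∀ i j, gen hp n • B i j = B i j := by
  rcases isEmpty_or_nonempty m with hm | ⟨⟨i₁⟩⟩
  · exact fun i => isEmptyElim i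
  set π : ℝ := ‖(p : PadicBase F p hp)‖ with hπ
  have hπ0 : 0 < π := norm_pos_iff.mpr (by exact_mod_cast (Fact.out : p.Prime).ne_zero)
  have hπ1 : π < 1 := PadicBase.norm_p_lt_one hp
  have hπ2 : π ^ 2 < 1 := pow_lt_one₀ hπ0.le hπ1 two_ne_zero
  have hr0 : 0 ≤ r := (norm_nonneg _).trans (hV₁r i₁ i₁)
  have hr1 : r < 1 := hr.trans hπ2
  -- `RB = R_n(B)` entrywise, `C = B − RB`
  set RB : Matrix m m (CompletedAlgClosure F) := Matrix.of fun k l => Rhat hp n ⟨B k l, hB k l⟩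
    with hRB_def
  have hRB_apply : ∀ k l, RB k l = Rhat hp n ⟨B k l, hB k l⟩ := fun k l => rfl
  have hRBX : ∀ k l, RB k l ∈ X hp := fun k l => by rw [hRB_apply]; exact Rhat_mem_X hp hn _
  have hγRB : ∀ k l, gen hp n • RB k l = RB k l := fun k l => by
    rw [hRB_apply]; exact gen_smul_Rhat hp hn _
  -- `R_n(B) = V₁ R_n(B) V₂`
  have hkey : ∀ i j, RB i j = (V₁ * RB * V₂) i j := by
    intro i j
    have hγBij : gen hp n • B i j = (V₁ * B * V₂) i j := by
      have h := congrFun (congrFun hγB i) j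
      rwa [Matrix.map_apply] at h
    have h1 := Rhat_genX hp hn ⟨B i j, hB i j⟩
    simp only [genX] at h1
    have hmem : (V₁ * B * V₂) i j ∈ X hp := by rw [← hγBij]; exact smul_mem_X hp _ (hB i j)
    have h2 : (⟨gen hp n • B i j, smul_mem_X hp _ (hB i j)⟩ : X hp) = ⟨(V₁ * B * V₂) i j, hmem⟩ :=
      Subtype.ext hγBij
    rw [hRB_apply, ← h1, h2, Rhat_mul_mul_apply hp hn hB hV₁ hV₂ hγV₁ hγV₂ i j hmem]
  -- hence `γ(C) = V₁ C V₂` and `γ C − C = (V₁ − 1) C V₂ + C (V₂ − 1)`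
  have hCX : ∀ i j, (B - RB) i j ∈ X hp := fun i j => by
    rw [Matrix.sub_apply]; exact sub_mem_X hp (hB i j) (hRBX i j)
  have hγC : ∀ i j, gen hp n • (B - RB) i j - (B - RB) i j =
      ((V₁ - 1) * (B - RB) * V₂ + (B - RB) * (V₂ - 1)) i j := by
    intro i j
    have hmat : (V₁ - 1) * (B - RB) * V₂ + (B - RB) * (V₂ - 1) = V₁ * B * V₂ - V₁ * RB * V₂ - (B - RB) := by
      noncomm_ring
    have hγBij : gen hp n • B i j = (V₁ * B * V₂) i j := by
      have h := congrFun (congrFun hγB i) j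
      rwa [Matrix.map_apply] at h
    rw [hmat, Matrix.sub_apply, Matrix.sub_apply, Matrix.sub_apply, smul_sub, hγBij, hγRB, ← hkey,
      Matrix.sub_apply]
  -- norms: `‖V₂‖ ≤ 1`
  have hV₂n : ∀ i j, ‖V₂ i j‖ ≤ 1 := by
    intro i j
    have h := (norm_one_add_apply_le hr1.le hV₂r i j).1
    rwa [add_sub_cancel] at h
  -- the largest entry of `C`
  haveI : Nonempty (m × m) := ⟨(i₁, i₁)⟩
  obtain ⟨⟨i₀, j₀⟩, -, hmax⟩ := Finset.exists_max_image (Finset.univ : Finset (m × m))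
    (fun q => ‖(B - RB) q.1 q.2‖) Finset.univ_nonempty
  set c : ℝ := ‖(B - RB) i₀ j₀‖ with hc
  have hc0 : 0 ≤ c := norm_nonneg _
  have hCc : ∀ i j, ‖(B - RB) i j‖ ≤ c := fun i j => hmax ⟨i, j⟩ (Finset.mem_univ _)
  -- `‖γ C − C‖ ≤ r c`
  have hbound : ∀ i j, ‖gen hp n • (B - RB) i j - (B - RB) i j‖ ≤ r * c := by
    intro i j
    rw [hγC]
    have h1 : ∀ i j, ‖((V₁ - 1) * (B - RB) * V₂) i j‖ ≤ r * c * 1 :=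
      norm_mul_apply_le (mul_nonneg hr0 hc0) zero_le_one (norm_mul_apply_le hr0 hc0 hV₁r hCc) hV₂n
    have h2 : ∀ i j, ‖((B - RB) * (V₂ - 1)) i j‖ ≤ c * r := norm_mul_apply_le hc0 hr0 hCc hV₂r
    refine (norm_add_apply_le h1 h2 i j).trans (max_le (le_of_eq (mul_one _)) (le_of_eq (mul_comm _ _)))
  -- (TS3): `R_n(C_{ij}) = 0`, so `‖C_{ij}‖ ≤ π⁻² ‖γ C_{ij} − C_{ij}‖ ≤ π⁻² r c`
  have hRC : ∀ i j, Rhat hp n ⟨(B - RB) i j, hCX i j⟩ = 0 := by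
    intro i j
    have h1 : (⟨(B - RB) i j, hCX i j⟩ : X hp) =
        ⟨((⟨B i j, hB i j⟩ : X hp) : CompletedAlgClosure F) - ((⟨RB i j, hRBX i j⟩ : X hp) : CompletedAlgClosure F),
          sub_mem_X hp (hB i j) (hRBX i j)⟩ := Subtype.ext (Matrix.sub_apply _ _ _ _)
    have h2 : Rhat hp n ⟨RB i j, hRBX i j⟩ = RB i j := by
      have h3 : (⟨RB i j, hRBX i j⟩ : X hp) = ⟨Rhat hp n ⟨B i j, hB i j⟩, Rhat_mem_X hp hn _⟩ :=
        Subtype.ext (hRB_apply i j)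
      rw [h3, Rhat_Rhat hp hn, hRB_apply]
    rw [h1, Rhat_sub hp hn, h2, hRB_apply, sub_self]
  have hTS3 : ∀ i j, ‖(B - RB) i j‖ ≤ π⁻¹ ^ 2 * (r * c) := by
    intro i j
    have h := norm_sub_Rhat_le hp hn ⟨(B - RB) i j, hCX i j⟩
    rw [hRC, sub_zero] at h
    exact h.trans (mul_le_mul_of_nonneg_left (hbound i j) (pow_nonneg (inv_nonneg.mpr hπ0.le) 2))
  -- `c ≤ (π⁻² r) c` with `π⁻² r < 1` forces `c = 0`
  have hθ : π⁻¹ ^ 2 * r < 1 := by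
    rw [inv_pow, inv_mul_lt_iff₀ (pow_pos hπ0 2), mul_one]; exact hr
  have hc_eq : c = 0 := by
    by_contra hne
    have hcpos : 0 < c := lt_of_le_of_ne hc0 (Ne.symm hne)
    have h := hTS3 i₀ j₀
    rw [← hc, ← mul_assoc] at h
    exact absurd h (not_le.mpr (mul_lt_of_lt_one_left hcpos hθ))
  -- conclusion: `B = R_n(B)` entrywise, which is `γ`-fixed
  intro i j
  have h0 : (B - RB) i j = 0 := by
    have h := hCc i j; rw [hc_eq] at h; exact norm_le_zero_iff.mp h
  rw [Matrix.sub_apply, sub_eq_zero] at h0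
  rw [h0]; exact hγRB i j

/-! ### Propagation along commuting elements (Berger–Colmez, Prop. 3.2.6, last step) -/

/-- `G₀` acts on matrices over `X` compatibly with inversion: if `γ` fixes `W` entrywise then it fixes
`W⁻¹` entrywise. [folklore] -/
private theorem map_inv_eq_of_map_eq {n : ℕ} {W : Matrix m m (CompletedAlgClosure F)}
    (hdet : IsUnit W.det) (hγW : ∀ i j, gen hp n • W i j = W i j) (i j : m) :
    gen hp n • W⁻¹ i j = W⁻¹ i j := by
  set f : CompletedAlgClosure F →+* CompletedAlgClosure F :=
    MulSemiringAction.toRingHom (BaseGaloisGroup hp) (CompletedAlgClosure F) (gen hp n) with hf_def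
  have hWf : W.map f = W := by
    ext k l; rw [Matrix.map_apply]; exact hγW k l
  have h1 : (W⁻¹).map f * W = 1 := by
    calc (W⁻¹).map f * W = (W⁻¹).map f * W.map f := by rw [hWf]
      _ = (W⁻¹ * W).map f := by rw [← Matrix.map_mul]
      _ = 1 := by rw [Matrix.nonsing_inv_mul W hdet, Matrix.map_one f (map_zero f) (map_one f)]
  have h2 : W⁻¹ = (W⁻¹).map f := Matrix.inv_eq_left_inv h1
  have h3 := congrFun (congrFun h2 i) j
  rw [Matrix.map_apply] at h3
  exact h3.symm

/-- ★ **Propagation of decompletion (Berger–Colmez, Prop. 3.2.6, last step; cyclotomic tower).** Let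
`n ≥ 2`, `γ = γ_n`, `τ ∈ G₀`, let `W ∈ M_d(X)` be fixed by `γ` entrywise with `‖W − 1‖ ≤ r < ‖p‖²`, and let
`V ∈ M_d(X)` satisfy `γ(V) = W⁻¹ · V · τ(W)`. Then `γ` fixes `V` entrywise. (For a `1`-cocycle `σ ↦ V_σ`
on `G₀` with values in `GL_d(X)` and `W = V_γ ∈ GL_d(K_n)`, the cocycle relations
`V_γ γ(V_τ) = V_{γτ}`, `V_τ τ(V_γ) = V_{τγ}` and `V_{γτ} = V_{τγ}` — `G₀` acts on `X` through an abelian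
quotient and the cocycle is inflated — give exactly this relation, so every `V_τ` lies in `GL_d(K_n)`.)
[cite: BergerColmez2008, Lemme 3.2.5 and Prop. 3.2.6] -/
theorem matrix_gen_smul_eq_of_map_eq_inv_mul_map {n : ℕ} (hn : 2 ≤ n) (τ : BaseGaloisGroup hp)
    {W V : Matrix m m (CompletedAlgClosure F)} (hW : ∀ i j, W i j ∈ X hp)
    (hγW : ∀ i j, gen hp n • W i j = W i j) {r : ℝ} (hr : r < ‖(p : PadicBase F p hp)‖ ^ 2)
    (hWr : ∀ i j, ‖(W - 1) i j‖ ≤ r) (hV : ∀ i j, V i j ∈ X hp)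
    (hγV : (V.map fun x => gen hp n • x) = W⁻¹ * V * W.map fun x => τ • x) :
    ∀ i j, gen hp n • V i j = V i j := by
  rcases isEmpty_or_nonempty m with hm | ⟨⟨i₁⟩⟩
  · exact fun i => isEmptyElim i
  have hπ0 : 0 < ‖(p : PadicBase F p hp)‖ :=
    norm_pos_iff.mpr (by exact_mod_cast (Fact.out : p.Prime).ne_zero)
  have hπ2 : ‖(p : PadicBase F p hp)‖ ^ 2 < 1 :=
    pow_lt_one₀ hπ0.le (PadicBase.norm_p_lt_one hp) two_ne_zero
  have hr0 : 0 ≤ r := (norm_nonneg _).trans (hWr i₁ i₁)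
  have hr1 : r < 1 := hr.trans hπ2
  obtain ⟨hdet, hWinv⟩ := isUnit_det_and_norm_inv_sub_one_le hr0 hr1 hWr
  refine matrix_gen_smul_eq_of_map_eq_mul_mul hp hn hV (fun i j => inv_apply_mem_X hp hW i j)
    (fun i j => map_smul_apply_mem_X hp τ hW i j) (map_inv_eq_of_map_eq hp hdet hγW)
    (fun i j => ?_) hr hWinv (fun i j => ?_) hγV
  · rw [Matrix.map_apply]; exact gen_smul_base_smul_eq hp hn τ (hW i j) (hγW i j)
  · rw [Matrix.sub_apply, Matrix.map_apply, ← smul_one_apply hp τ i j, ← smul_sub,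
      CompletedAlgClosure.norm_base_smul hp, ← Matrix.sub_apply]
    exact hWr i j

end TateTrace

end Literature.NumberTheory.PAdicHodge
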